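import Summits.HodgeConjecture.HodgeConjecture.Theorems.F0P6aPELWitnessEDefs                -- (β1) DEFS LEAF (D), «M-63»: `AuxChartGS` with the ED. 5 fields
import Literature.AlgebraicGeometry.ShimuraVarieties.UnitaryCurveSiegelChartMoverOfClass                  -- ★ (REP) p848074+p848113 (LA6-p01)
import Summits.HodgeConjecture.HodgeConjecture.Theorems.F0P6aCMHomKernelShape                             -- ★ ONE-CALL ED. 3 p848183 (LA6-p02)
import Literature.AlgebraicGeometry.AbelianSchemes.RingActionOfPointwiseIdentities
import Literature.AlgebraicGeometry.AbelianSchemes.AbelianSchemeEndomorphismComplexDescent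
import Literature.AlgebraicGeometry.AbelianSchemes.RingActionOfMarkedReadings
import Literature.AlgebraicGeometry.AbelianSchemes.ReadingComplexDescent
import Literature.AlgebraicGeometry.Motives.VarietiesGeometricallyIntegralProofs
import Literature.AlgebraicGeometry.Motives.VarietiesProperProofs
import Literature.AlgebraicGeometry.Morphisms.ConnectedComponentRationalPoint
import Literature.AlgebraicGeometry.AbelianSchemes.PolarizedAbelianSchemeWithLevelBaseChange
import Literature.AlgebraicGeometry.HodgeTheory.AbelianVarietyCotangentCharpolyAnalyticRep
import Literature.AlgebraicGeometry.Motives.BaseChangePointsOfTower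
import Literature.AlgebraicGeometry.ModuliOfAbelianVarieties.SiegelShimuraSetPrincipalDissection
import Summits.HodgeConjecture.HodgeConjecture.Theorems.F0P6aRosatiOverOfReading                 -- ★ E6-R p847226 (σR by name, v6)
import HarnessLib
import Literature.AlgebraicGeometry.ShimuraVarieties.UnitaryShimuraCurveSpecialPointComponentsTower
import Literature.AlgebraicGeometry.AbelianSchemes.AbelianSchemeFibreEndomorphismOfBaseChange
import Literature.AlgebraicGeometry.AbelianSchemes.AbelianSchemeGaloisFibreConditionOfPoints
import Literature.AlgebraicGeometry.AbelianSchemes.AbelianSchemeGaloisFibreConditionOfConjugateReading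
import Literature.AlgebraicGeometry.ModuliOfAbelianVarieties.SiegelConjFibreIsoEqCMIso
import Literature.AlgebraicGeometry.ModuliOfAbelianVarieties.SiegelAdelicMarkingUnitFrameTorsionReading

/-!
# `F0P6aSigmaGAL` — ★ RE-HOME (rung-0 re-homing task, books INVENTORY §8.4 M-3; LEAD F0P6-plan (g4) «M-72») of the crux workfile `Lines/F0_P6a_SigmaGAL.lean`

This `Theorems/` module is the TREE BYTES of `Summits/HodgeConjecture/HodgeConjecture/Cruxes/HLiu418/Lines/F0_P6a_SigmaGAL.lean` (edition of record,
tree sha16 44b59a9cab2fb912, 611 l., code-`sorry`-free) with the NAMESPACE KEPT — `Summit.HodgeConjecture.HodgeConjecture.Cruxes.HLiu418.F0P6aSigmaGAL` — so that every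
fully-qualified name (`ReadsCGalois`, `ReadsCReading`, `KCMInputs`, `kcm_chain_of_cm_recip`, `exists_artin_twist_classes`, `stub_KCM`, `map_toFun_eq_mapMatrix_of_readings`, `exists_fieldPoint_fibre_comp_galA_eq`, `readsCGalois_of_readsCReading`, `sigmaGAL_of_stub`; 10 declarations) is UNCHANGED; only this module
docstring is re-headed and the `Lines` imports are switched to their ★ re-homed twins (`F0_P6a_PELWitnessEDefs` → `Theorems.F0P6aPELWitnessEDefs`).  Why a re-home: a `Theorems/` file cannot import a `Lines/` workfile (F0P6-ref1 o-6), and closing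
stmt-HodgeConjecture-24832 `--as proved --by <Theorems decl>` at rung 0 needs the sorry-free Lines chain behind the gate (RE-HOME MAP v1.1, LA7-plan (g4),
2026-09-02; director g27 s1336 (R1)–(R3)).    Lines importers of the original: `F0_P6a_StubE6`.
After this file is ★ the Lines workfile is meant to become a one-import SHIM of it (a `Lines/` write, batched per cone on the LEAD's word), so no
environment ever holds two copies (NO-CROSS-IMPORT rule, «M-72» (3)).  It asserts nothing beyond what the workfile already proves.

## Original module docstring (verbatim)
# Σ-GAL LINE SKELETON v3 = v2 + `stub_KCM` PAID (LA6-p01 (g0)) + re-based on the Defs leaf (β1) (A-p04 (g24), HOME-first; LEAD heir F0P6-plan (g3) «=» 2026-09-02T01:36:19Z): the Σ-GAL half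
# `ReadsCReading C ε Y hY → ReadsCGalois C ε Y hY` of the E6 closer (A-p06 (g33) v7 head `stub_E6_of_junction_sigmaAN_sigmaGAL`, binder `hGAL`),
# composition SORRY-FREE over ★ B-γ ∕ H0 ∕ G2a ∕ G2b-α ∕ H1 ∕ KERNEL ED. 3, with ONE socket `stub_KCM` = the CM inputs (K-a)+(K-b)+(K-c) of
# A-p09 (g22)'s kernel spec v2 BY VALUE in the KERNEL's binder shape ((K-c) = A-p15 (g18)'s; (K-a)(K-b) = A-p04's).

`ReadsCGalois` ∕ `ReadsCReading` are A-p06 (g33)'s closer v7 defs COPIED VERBATIM (words of record; this HOME file cannot import a HOME file) — when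
merged under the closer they are his.  Not a tree file; no tree write without the LEAD's «M-» word.  HC_CM is proved only modulo the 2 remaining named
inputs (hLiu418 24832, h413 24833); count-neutral `--supports 24832` capital.
-/

set_option autoImplicit false

noncomputable section

namespace Summit.HodgeConjecture.HodgeConjecture.Cruxes.HLiu418.F0P6aSigmaGAL

set_option linter.dupNamespace false

open CategoryTheory CategoryTheory.Limits NumberField IsDedekindDomain MulAction Matrix AlgebraicGeometry
open scoped Matrix ComplexOrder Polynomial MonObj
open Literature.AlgebraicGeometry.Motives (SchemeOver AlgPoints ComplexPoints specOver)
open Literature.AlgebraicGeometry.Motives.AbelianVariety (bcSpec)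
open Literature.AlgebraicGeometry.Motives.GaloisDescent (gal bc gal_fst gal_snd)
open Literature.AlgebraicGeometry.Motives.AbelianVariety (specAut specAut_mul specAut_one specAut_comp_bcSpec)
open Literature.AlgebraicGeometry.AbelianSchemes (PolarizedAbelianSchemeWithLevel AbelianSchemeOver)
open Literature.AlgebraicGeometry.ModuliOfAbelianVarieties
open Literature.AlgebraicGeometry.ShimuraVarieties Literature.AlgebraicGeometry.ShimuraVarieties.UnitaryCanonicalModel
open Literature.NumberTheory.Automorphic Literature.NumberTheory.Automorphic.UnitaryGroup
open Literature.NumberTheory.Automorphic.Liu2021.AppendixC (C5.OpenCompactSubgroup C5.SmallLevel)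
open Literature.Geometry.Kaehler (ComplexTorus)
open Summit.HodgeConjecture.HodgeConjecture.Cruxes.HLiu418.F0P6aPELWitnessE (GSAdele IsCMTypeThrough mOf AuxChartGS)
open Literature.AlgebraicGeometry.ShimuraVarieties.UnitaryCurve (exists_mover_of_mk_eq_mk_frame)
open Summit.HodgeConjecture.HodgeConjecture.Theorems.F0P6aCMHomKernelShape (exists_cmConjHom_kernelShape_frame_of_restrictScalars)

/-! ## §0 Context and the closer's sockets BY VALUE (copied verbatim from A-p06 (g33) E6 closer skeleton v7 2d63bea8) -/

section Sockets

variable {F : Type} [Field F] [NumberField F] [IsCMField F] {ι₁ : F →+* ℂ} {Jstar : Matrix (Fin 2) (Fin 2) F}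
  {K₀ : C5.OpenCompactSubgroup (GSAdele F Jstar)} {S : RecordSystemGS F Jstar ι₁ K₀} {Kc : C5.SmallLevel K₀}
  {Fi : Type} [Field Fi] [NumberField Fi] [Algebra F Fi] {τE : Fi →+* ℂ} {Φ : Set (F →+* ℂ)}


/-- Σ-GAL **`ReadsCGalois C ε Y hY`** — clause (i) of `ReadsC` ALONE (by value, token for token): the family `Y` commutes with the canonical
Galois automorphisms `1 ×_X gal σ`, `σ ∈ Aut(ℂ∕Fᵢ)`.  Socket of the E6-γ hand (A-p09): for a family that READS (clause (ii)) it follows by rigidity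
(★ B-γ `forall_gal_comp_eq_of_forall_exists_fieldPoint`: one CM point per connected component of `X_ℂ`) from the CM reading at special points
(★ `SiegelCMConjugationHomIntertwines`). [cite: Milne2005ShimuraVarieties, §13 Prop. 13.1 p. 117] [cite: MumfordFogartyKirwan1994, Ch. 6 §1 Corollary 6.2 (p. 116)] -/
def ReadsCGalois (C : AuxChartGS F ι₁ Jstar K₀ S Kc Fi τE Φ)
    (ε : (Literature.AlgebraicGeometry.Motives.baseChange F Fi).obj (S.M.obj Kc) ⟶
        (Literature.AlgebraicGeometry.Motives.baseChange ℚ Fi).obj C.𝓜.M)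
    (Y : letI : Algebra Fi ℂ := τE.toAlgebra
      𝓞 F → (((C.𝓜.univ.baseChange (ε.left ≫ pullback.fst C.𝓜.M.hom (bcSpec ℚ Fi))).A.baseChange
        (pullback.fst ((Literature.AlgebraicGeometry.Motives.baseChange F Fi).obj (S.M.obj Kc)).hom (bcSpec Fi ℂ))).X ⟶
        ((C.𝓜.univ.baseChange (ε.left ≫ pullback.fst C.𝓜.M.hom (bcSpec ℚ Fi))).A.baseChange
        (pullback.fst ((Literature.AlgebraicGeometry.Motives.baseChange F Fi).obj (S.M.obj Kc)).hom (bcSpec Fi ℂ))).X))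
    (_hY : letI : Algebra Fi ℂ := τE.toAlgebra; ∀ b, IsMonHom (Y b)) : Prop :=
  letI P := C.𝓜.univ.baseChange (ε.left ≫ pullback.fst C.𝓜.M.hom (bcSpec ℚ Fi))
  letI X := (Literature.AlgebraicGeometry.Motives.baseChange F Fi).obj (S.M.obj Kc)
  letI : Algebra Fi ℂ := τE.toAlgebra
  letI prX := pullback.fst X.hom (bcSpec Fi ℂ)
  (∀ (b : 𝓞 F) (σ : ℂ ≃ₐ[Fi] ℂ),
    pullback.map P.A.X.hom prX P.A.X.hom prX (𝟙 P.A.X.left) (gal ℂ X σ) (𝟙 X.left)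
        (by rw [Category.comp_id, Category.id_comp]) (by rw [Category.comp_id, gal_fst]) ≫ (Y b).left =
      (Y b).left ≫ pullback.map P.A.X.hom prX P.A.X.hom prX (𝟙 P.A.X.left) (gal ℂ X σ) (𝟙 X.left)
        (by rw [Category.comp_id, Category.id_comp]) (by rw [Category.comp_id, gal_fst]))

/-- Σ-AN **`ReadsCReading C ε Y hY`** — clause (ii) of `ReadsC` ALONE (by value, token for token): the family `Y` READS as `Mρ a b` through THE
admissible marking at every complex point of `X` (relation form in the total space `P.A ×_X X_ℂ`).  Socket of the analytic hand (A-p06): ★ P-3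
`siegelUniversalFamilyUniformisation` on the pieces + ★ E6-lin + `Z_equivariant` + ★ MRK-TRANSPORT for the chart compatibility + ★ E6-an′
`exists_isMonHom_of_chartReadings_of_additive` (p847428: glue ★ U6-b′ + GAGA ★ E6-an). [cite: Lange2023AbelianVarietiesComplex, §3.4 Proposition 3.4.1]
[cite: Kottwitz1992, §5 (p. 390)] -/
def ReadsCReading (C : AuxChartGS F ι₁ Jstar K₀ S Kc Fi τE Φ)
    (ε : (Literature.AlgebraicGeometry.Motives.baseChange F Fi).obj (S.M.obj Kc) ⟶
        (Literature.AlgebraicGeometry.Motives.baseChange ℚ Fi).obj C.𝓜.M)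
    (Y : letI : Algebra Fi ℂ := τE.toAlgebra
      𝓞 F → (((C.𝓜.univ.baseChange (ε.left ≫ pullback.fst C.𝓜.M.hom (bcSpec ℚ Fi))).A.baseChange
        (pullback.fst ((Literature.AlgebraicGeometry.Motives.baseChange F Fi).obj (S.M.obj Kc)).hom (bcSpec Fi ℂ))).X ⟶
        ((C.𝓜.univ.baseChange (ε.left ≫ pullback.fst C.𝓜.M.hom (bcSpec ℚ Fi))).A.baseChange
        (pullback.fst ((Literature.AlgebraicGeometry.Motives.baseChange F Fi).obj (S.M.obj Kc)).hom (bcSpec Fi ℂ))).X))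
    (_hY : letI : Algebra Fi ℂ := τE.toAlgebra; ∀ b, IsMonHom (Y b)) : Prop :=
  letI P := C.𝓜.univ.baseChange (ε.left ≫ pullback.fst C.𝓜.M.hom (bcSpec ℚ Fi))
  letI X := (Literature.AlgebraicGeometry.Motives.baseChange F Fi).obj (S.M.obj Kc)
  letI : Algebra Fi ℂ := τE.toAlgebra
  letI prX := pullback.fst X.hom (bcSpec Fi ℂ)
  ∀ (x : ComplexPoints X) (Pflat : letI : Algebra F ℂ := ι₁.toAlgebra; ComplexPoints (S.M.obj Kc)),
    Pflat.left = x.left ≫ pullback.fst (S.M.obj Kc).hom (bcSpec F Fi) →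
    ∃ (v : Fin 2 → ℂ) (hv : v ∈ negCone (Jstar.map ι₁)) (a : GSAdele F Jstar),
      (letI : Algebra F ℂ := ι₁.toAlgebra; S.pts Kc Pflat) = ShimuraSetGS.mk F Jstar ι₁ Kc.1.1 v hv a ∧
      ∀ (u : finAdeleQˣ) (r : gspFinAdelic C.δ),
        (∀ w, Valued.v ((u : finAdeleQ) w) = 1) →
        (u : finAdeleQ) - ((C.piece a : ZMod C.N).val : ℕ) ∈ levelIdeal C.N →
        r ∈ principalLevelSubgroup C.δ 1 →
        IsMultiplier (typeFormOver C.δ finAdeleQ) (r : GL (Fin C.g ⊕ Fin C.g) finAdeleQ) u →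
        ((r : GL (Fin C.g ⊕ Fin C.g) finAdeleQ) : Matrix (Fin C.g ⊕ Fin C.g) (Fin C.g ⊕ Fin C.g) finAdeleQ) =
          Matrix.fromBlocks 1 0 0 ((u : finAdeleQ) • (1 : Matrix (Fin C.g) (Fin C.g) finAdeleQ)) →
        ∃ (m : SiegelAdelicMarking ⟨SiegelModuli.jOfSiegel C.δ (C.Z a v),
              SiegelComplexRecordSystem.jOfSiegel_mem_C0pm C.hδ.1 (C.Z_mem a v hv)⟩ r (P.A.fibre x.left).toAbelianVariety)
          (Θ : Literature.AlgebraicGeometry.Motives.CartierDivisor (P.A.fibre x.left).toAbelianVariety.X.left)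
          (Λ : P.level.SymplecticLift x.left Θ C.δ),
          Θ.IsAmple ∧ P.A.IsLambdaOfAt x.left P.D P.pol.lam Θ ∧
          (∀ ⦃M : ℕ⦄, C.N ∣ M → M ≠ 0 → ∀ (y : Fin C.g ⊕ Fin C.g → ZMod M) (w : Fin C.g ⊕ Fin C.g → ℚ),
            AdelicCongr ((r⁻¹ : gspFinAdelic C.δ) : GL (Fin C.g ⊕ Fin C.g) finAdeleQ) 1 w (fun i => ((y i).val : ℚ) / M) →
              ((Λ.lift M (Multiplicative.ofAdd y)) : (P.A.fibre x.left).toAbelianVariety.Points ℂ) = m.r w) ∧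
          m.γ = 1 ∧ (∀ w : Fin C.g ⊕ Fin C.g → ℝ, m.Ψ w = siegelPeriodMap C.δ (C.Z a v) w) ∧
          ∀ (b : 𝓞 F) (t : ComplexTorus m.Ψ) (q : Spec (.of ℂ) ⟶ pullback P.A.X.hom prX),
            q ≫ pullback.fst P.A.X.hom prX = P.A.fibrePointToLeft x.left (m.toFun t) →
            q ≫ pullback.snd P.A.X.hom prX ≫ pullback.snd X.hom (bcSpec Fi ℂ) = 𝟙 _ →
            (q ≫ (Y b).left) ≫ pullback.fst P.A.X.hom prX =
              P.A.fibrePointToLeft x.left (m.toFun (ComplexTorus.mapMatrix m.Ψ m.Ψ (C.Mρ a b) t))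


/-! ## §1 THE SOCKET (K-a)+(K-b)+(K-c) BY VALUE — the CM inputs of ★ KERNEL ED. 3 `SiegelAdelicMarking.conjugate_comp_conjFibreIso_eq_of_lifts_of_hom` at a
special point of `X` and its `σ`-twist, for the two σ1 (`ReadsCReading`) admissibility data -/

/-- **`KCMInputs C ε Y hY` — THE CM KERNEL INPUTS at every special complex point** (A-p09 (g22) kernel spec v2 (K-CM)(a)(b)(c), by value): for
`b ∈ 𝒪_F`, `σ ∈ Aut(ℂ∕Fᵢ)`, an honest base point `s : Spec ℂ → X` lying over the FLAT special point `Pflat = (S.pts Kc)⁻¹ [ι₁w, a₀K]`, σ1's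
representative `(v, a)` of that class with its ADMISSIBILITY DATUM `(m₁, Θ₁, Λ₁)` of the fibre `P.A_s` at `(J(Z a v), rep (piece a))` (unit frame,
tautological coordinates), and the same at the twisted base point `Spec σ ≫ s` (flat point `Pflat′` over `Spec σ ≫ Pflat`, representative `(v′, a′)`,
datum `(m₂, Θ₂, Λ₂)`): there are a CM HOMOMORPHISM `f : (P.A_s)^σ ⟶ P.A_{Spec σ ≫ s}` and `k ∈ K_δ(N)` with the TORSION READING
`AdelicCongr (k·r₁⁻¹) r₂⁻¹ v w ⟹ f((m₁.r v)^σ) = m₂.r w` ((K-a)+(K-b): ★ `cmConjugationIsogenyAll_holds` at the CM structure of the special point,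
re-indexed along the class identity of E3R-S ∕ `f_recip`) and the CONGRUENCE PRESERVATION of `(ℓ, ℓ′) := (Mρ a b, Mρ a′ b)` ((K-c): F-linearity of the
lattice reading; A-p15 (g18)'s (M-fr)∕(D-lin)) — VERBATIM the binders `f hk hf ℓ ℓ′ hℓ` of ★ KERNEL ED. 3.
[cite: Milne2005ShimuraVarieties, §14 Prop. 14.12 p. 125; §6 Thm. 6.11 pp. 74–75] [cite: Deligne1971TravauxShimura, 4.16 p. 150] -/
def KCMInputs (C : AuxChartGS F ι₁ Jstar K₀ S Kc Fi τE Φ)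
    (ε : (Literature.AlgebraicGeometry.Motives.baseChange F Fi).obj (S.M.obj Kc) ⟶
        (Literature.AlgebraicGeometry.Motives.baseChange ℚ Fi).obj C.𝓜.M)
    (Y : letI : Algebra Fi ℂ := τE.toAlgebra
      𝓞 F → (((C.𝓜.univ.baseChange (ε.left ≫ pullback.fst C.𝓜.M.hom (bcSpec ℚ Fi))).A.baseChange
        (pullback.fst ((Literature.AlgebraicGeometry.Motives.baseChange F Fi).obj (S.M.obj Kc)).hom (bcSpec Fi ℂ))).X ⟶
        ((C.𝓜.univ.baseChange (ε.left ≫ pullback.fst C.𝓜.M.hom (bcSpec ℚ Fi))).A.baseChange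
        (pullback.fst ((Literature.AlgebraicGeometry.Motives.baseChange F Fi).obj (S.M.obj Kc)).hom (bcSpec Fi ℂ))).X))
    (_hY : letI : Algebra Fi ℂ := τE.toAlgebra; ∀ b, IsMonHom (Y b)) : Prop :=
  letI P := C.𝓜.univ.baseChange (ε.left ≫ pullback.fst C.𝓜.M.hom (bcSpec ℚ Fi))
  letI X := (Literature.AlgebraicGeometry.Motives.baseChange F Fi).obj (S.M.obj Kc)
  letI : Algebra Fi ℂ := τE.toAlgebra
  letI : Algebra F ℂ := ι₁.toAlgebra
  ∀ (b : 𝓞 F) (σ : ℂ ≃ₐ[Fi] ℂ)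
    -- the base point `s` of `X`, over the FLAT SPECIAL point `Pflat = (S.pts Kc)⁻¹ [ι₁ w, a₀]`
    (s : Spec (.of ℂ) ⟶ X.left) (w : Fin 2 → F) (hw : (fun i => ι₁ (w i)) ∈ negCone (Jstar.map ι₁)) (a₀ : GSAdele F Jstar)
    (Pflat : ComplexPoints (S.M.obj Kc)) (_hPflat : Pflat = (S.pts Kc).symm (ShimuraSetGS.mk F Jstar ι₁ Kc.1.1 (fun i => ι₁ (w i)) hw a₀))
    (_hs : s ≫ pullback.fst (S.M.obj Kc).hom (bcSpec F Fi) = Pflat.left)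
    -- σ1's representative of the class and its admissibility datum at `s`
    (v : Fin 2 → ℂ) (hv : v ∈ negCone (Jstar.map ι₁)) (a : GSAdele F Jstar)
    (_hpts : S.pts Kc Pflat = ShimuraSetGS.mk F Jstar ι₁ Kc.1.1 v hv a)
    (m₁ : SiegelAdelicMarking ⟨SiegelModuli.jOfSiegel C.δ (C.Z a v), SiegelComplexRecordSystem.jOfSiegel_mem_C0pm C.hδ.1 (C.Z_mem a v hv)⟩
      (C.rep (C.piece a)) (P.A.fibre s).toAbelianVariety)
    (Θ₁ : Literature.AlgebraicGeometry.Motives.CartierDivisor (P.A.fibre s).toAbelianVariety.X.left)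
    (Λ₁ : P.level.SymplecticLift s Θ₁ C.δ)
    (_ : Θ₁.IsAmple) (_ : P.A.IsLambdaOfAt s P.D P.pol.lam Θ₁)
    (_ : ∀ ⦃M : ℕ⦄, C.N ∣ M → M ≠ 0 → ∀ (y : Fin C.g ⊕ Fin C.g → ZMod M) (u : Fin C.g ⊕ Fin C.g → ℚ),
      AdelicCongr (((C.rep (C.piece a))⁻¹ : gspFinAdelic C.δ) : GL (Fin C.g ⊕ Fin C.g) finAdeleQ) 1 u (fun i => ((y i).val : ℚ) / M) →
        ((Λ₁.lift M (Multiplicative.ofAdd y)) : (P.A.fibre s).toAbelianVariety.Points ℂ) = m₁.r u)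
    (_ : m₁.γ = 1) (_ : ∀ u : Fin C.g ⊕ Fin C.g → ℝ, m₁.Ψ u = siegelPeriodMap C.δ (C.Z a v) u)
    -- the TWISTED flat point and σ1's representative ∕ datum at the twisted base point `Spec σ ≫ s`
    (Pflat' : ComplexPoints (S.M.obj Kc)) (_hPflat' : Pflat'.left = AbelianSchemeOver.specTwist σ.toRingEquiv ≫ Pflat.left)
    (v' : Fin 2 → ℂ) (hv' : v' ∈ negCone (Jstar.map ι₁)) (a' : GSAdele F Jstar)
    (_hpts' : S.pts Kc Pflat' = ShimuraSetGS.mk F Jstar ι₁ Kc.1.1 v' hv' a')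
    (m₂ : SiegelAdelicMarking ⟨SiegelModuli.jOfSiegel C.δ (C.Z a' v'), SiegelComplexRecordSystem.jOfSiegel_mem_C0pm C.hδ.1 (C.Z_mem a' v' hv')⟩
      (C.rep (C.piece a')) (P.A.fibre (AbelianSchemeOver.specTwist σ.toRingEquiv ≫ s)).toAbelianVariety)
    (Θ₂ : Literature.AlgebraicGeometry.Motives.CartierDivisor (P.A.fibre (AbelianSchemeOver.specTwist σ.toRingEquiv ≫ s)).toAbelianVariety.X.left)
    (Λ₂ : P.level.SymplecticLift (AbelianSchemeOver.specTwist σ.toRingEquiv ≫ s) Θ₂ C.δ)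
    (_ : Θ₂.IsAmple) (_ : P.A.IsLambdaOfAt (AbelianSchemeOver.specTwist σ.toRingEquiv ≫ s) P.D P.pol.lam Θ₂)
    (_ : ∀ ⦃M : ℕ⦄, C.N ∣ M → M ≠ 0 → ∀ (y : Fin C.g ⊕ Fin C.g → ZMod M) (u : Fin C.g ⊕ Fin C.g → ℚ),
      AdelicCongr (((C.rep (C.piece a'))⁻¹ : gspFinAdelic C.δ) : GL (Fin C.g ⊕ Fin C.g) finAdeleQ) 1 u (fun i => ((y i).val : ℚ) / M) →
        ((Λ₂.lift M (Multiplicative.ofAdd y)) :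
          (P.A.fibre (AbelianSchemeOver.specTwist σ.toRingEquiv ≫ s)).toAbelianVariety.Points ℂ) = m₂.r u)
    (_ : m₂.γ = 1) (_ : ∀ u : Fin C.g ⊕ Fin C.g → ℝ, m₂.Ψ u = siegelPeriodMap C.δ (C.Z a' v') u),
    ∃ (f : ((P.A.fibre s).toAbelianVariety).conjugate σ.toRingEquiv ⟶
          (P.A.fibre (AbelianSchemeOver.specTwist σ.toRingEquiv ≫ s)).toAbelianVariety)
      (k : gspFinAdelic C.δ), k ∈ principalLevelSubgroup C.δ C.N ∧
      (∀ v₀ w₀ : Fin C.g ⊕ Fin C.g → ℚ,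
        AdelicCongr ((k * (C.rep (C.piece a))⁻¹ : gspFinAdelic C.δ) : GL (Fin C.g ⊕ Fin C.g) finAdeleQ)
            (((C.rep (C.piece a'))⁻¹ : gspFinAdelic C.δ) : GL (Fin C.g ⊕ Fin C.g) finAdeleQ) v₀ w₀ →
          AlgPoints.map f.hom.hom.hom ((P.A.fibre s).toAbelianVariety.conjPoints σ.toRingEquiv (m₁.r v₀)) = m₂.r w₀) ∧
      (∀ v₀ w₀ : Fin C.g ⊕ Fin C.g → ℚ,
        AdelicCongr ((k * (C.rep (C.piece a))⁻¹ : gspFinAdelic C.δ) : GL (Fin C.g ⊕ Fin C.g) finAdeleQ)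
            (((C.rep (C.piece a'))⁻¹ : gspFinAdelic C.δ) : GL (Fin C.g ⊕ Fin C.g) finAdeleQ) v₀ w₀ →
          AdelicCongr ((k * (C.rep (C.piece a))⁻¹ : gspFinAdelic C.δ) : GL (Fin C.g ⊕ Fin C.g) finAdeleQ)
            (((C.rep (C.piece a'))⁻¹ : gspFinAdelic C.δ) : GL (Fin C.g ⊕ Fin C.g) finAdeleQ)
            (((C.Mρ a b).map (Int.cast : ℤ → ℚ)) *ᵥ v₀) (((C.Mρ a' b).map (Int.cast : ℤ → ℚ)) *ᵥ w₀))

end Sockets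

/-! ## §1b (LA6-p01 (g0) PAYMENT HELPERS for `stub_KCM`) -/

section KCMPayment

open Literature.AlgebraicGeometry.Motives (AbelianVariety CMType)
open Literature.AlgebraicGeometry.ShimuraVarieties.UnitaryCurve (exists_mover_of_mk_eq_mk_frame)
open Summit.HodgeConjecture.HodgeConjecture.Theorems.F0P6aCMHomKernelShape (exists_cmConjHom_kernelShape_frame_of_restrictScalars)

/-- **THE CM CHAIN FOR THE ABSTRACT CHART** (socket currency): `C.cm_recip` (ED. 5) ⊕ ★ `exists_mover_of_mk_eq_mk_frame` ×2 ((D-lin) = `C.bq_comm_ρ₀`) ⊕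
★ ONE-CALL `exists_cmConjHom_kernelShape_frame_of_restrictScalars` — for ANY representatives `(v, a)`, `(v′, a′)` of the special class `[ι₁w, a₀]` and of
its twisted class `[ι₁w, d·a₀]` and ANY complex abelian varieties marked by `[J(Z a v), rep(piece a)]`, `[J(Z a′ v′), rep(piece a′)]`: the KERNEL's
`(f, k, hk, hf, hℓ ∀ b)`. [cite: Milne2005ShimuraVarieties, §5 Lemma 5.13 p. 57, Def. 12.8 (62) p. 114, §14 Prop. 14.12 p. 125] [cite: Shimura1998, §18.6 Thm. 18.6 pp. 124–127] -/
theorem kcm_chain_of_cm_recip {F : Type} [Field F] [NumberField F] [IsCMField F] {ι₁ : F →+* ℂ}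
    {Jstar : Matrix (Fin 2) (Fin 2) F} {K₀ : C5.OpenCompactSubgroup (GSAdele F Jstar)} {S : RecordSystemGS F Jstar ι₁ K₀} {Kc : C5.SmallLevel K₀}
    {Fi : Type} [Field Fi] [NumberField Fi] [Algebra F Fi] {τE : Fi →+* ℂ} {Φ : Set (F →+* ℂ)} (C : AuxChartGS F ι₁ Jstar K₀ S Kc Fi τE Φ)
    (σ : letI : Algebra Fi ℂ := τE.toAlgebra; ℂ ≃ₐ[Fi] ℂ) (s : (FiniteAdeleRing (𝓞 F) F)ˣ)
    (hs : letI : Algebra Fi ℂ := τE.toAlgebra; IsArtinCorrespondent F ι₁ s σ.toRingEquiv)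
    (w : Fin 2 → F) (hw : (fun i => ι₁ (w i)) ∈ negCone (Jstar.map ι₁)) (d : GSAdele F Jstar) (hd : IsDiagTwistGS F Jstar w (recipFactor F s) d)
    (a₀ : GSAdele F Jstar)
    (v : Fin 2 → ℂ) (hv : v ∈ negCone (Jstar.map ι₁)) (a : GSAdele F Jstar)
    (h₁ : ShimuraSetGS.mk F Jstar ι₁ Kc.1.1 v hv a = ShimuraSetGS.mk F Jstar ι₁ Kc.1.1 (fun i => ι₁ (w i)) hw a₀)
    (v' : Fin 2 → ℂ) (hv' : v' ∈ negCone (Jstar.map ι₁)) (a' : GSAdele F Jstar)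
    (h₂ : ShimuraSetGS.mk F Jstar ι₁ Kc.1.1 v' hv' a' = ShimuraSetGS.mk F Jstar ι₁ Kc.1.1 (fun i => ι₁ (w i)) hw (d * a₀))
    {A A₂ : AbelianVariety ℂ}
    (m₁ : SiegelAdelicMarking ⟨SiegelModuli.jOfSiegel C.δ (C.Z a v), SiegelComplexRecordSystem.jOfSiegel_mem_C0pm C.hδ.1 (C.Z_mem a v hv)⟩
      (C.rep (C.piece a)) A)
    (m₂ : SiegelAdelicMarking ⟨SiegelModuli.jOfSiegel C.δ (C.Z a' v'), SiegelComplexRecordSystem.jOfSiegel_mem_C0pm C.hδ.1 (C.Z_mem a' v' hv')⟩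
      (C.rep (C.piece a')) A₂) :
    letI : Algebra Fi ℂ := τE.toAlgebra
    ∃ (f : A.conjugate σ.toRingEquiv ⟶ A₂) (k : ↥(gspFinAdelic C.δ)),
      k ∈ principalLevelSubgroup C.δ C.N ∧
      (∀ x y : Fin C.g ⊕ Fin C.g → ℚ,
        AdelicCongr ((k * (C.rep (C.piece a))⁻¹ : ↥(gspFinAdelic C.δ)) : GL (Fin C.g ⊕ Fin C.g) finAdeleQ)
            (((C.rep (C.piece a'))⁻¹ : ↥(gspFinAdelic C.δ)) : GL (Fin C.g ⊕ Fin C.g) finAdeleQ) x y →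
          AlgPoints.map f.hom.hom.hom (A.conjPoints σ.toRingEquiv (m₁.r x)) = m₂.r y) ∧
      ∀ (b : 𝓞 F) (x y : Fin C.g ⊕ Fin C.g → ℚ),
        AdelicCongr ((k * (C.rep (C.piece a))⁻¹ : ↥(gspFinAdelic C.δ)) : GL (Fin C.g ⊕ Fin C.g) finAdeleQ)
            (((C.rep (C.piece a'))⁻¹ : ↥(gspFinAdelic C.δ)) : GL (Fin C.g ⊕ Fin C.g) finAdeleQ) x y →
        AdelicCongr ((k * (C.rep (C.piece a))⁻¹ : ↥(gspFinAdelic C.δ)) : GL (Fin C.g ⊕ Fin C.g) finAdeleQ)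
            (((C.rep (C.piece a'))⁻¹ : ↥(gspFinAdelic C.δ)) : GL (Fin C.g ⊕ Fin C.g) finAdeleQ)
            ((C.Mρ a b).map (Int.cast : ℤ → ℚ) *ᵥ x) ((C.Mρ a' b).map (Int.cast : ℤ → ℚ) *ᵥ y) := by
  letI : Algebra Fi ℂ := τE.toAlgebra
  obtain ⟨E, hEnf, c, Ψ, sE, r, d', hsp, hpin, hE, hσE, hsE, hr, ⟨t, ht, hsplit⟩, hK⟩ := C.cm_recip σ s hs w hw d hd a₀
  haveI : NumberField ↥E := hEnf
  have h₂' : ShimuraSetGS.mk F Jstar ι₁ Kc.1.1 v' hv' a' = ShimuraSetGS.mk F Jstar ι₁ Kc.1.1 (fun i => ι₁ (w i)) hw (d' * a₀) :=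
    h₂.trans (hK Kc.1.1)
  obtain ⟨q₁, hJ₁, hq₁, hM₁⟩ := exists_mover_of_mk_eq_mk_frame C.J C.hJsmul C.b C.bq C.hb C.hJrat Kc.1.1 C.hle C.piece C.Z C.rep C.q C.q_spec
    (fun b' : 𝓞 F => C.ρ₀ b') (fun a'' (b' : 𝓞 F) => C.Mρ a'' b') C.Mρ_frame C.bq_comm_ρ₀ v hv a (fun i => ι₁ (w i)) hw a₀ h₁
  obtain ⟨q₂, hJ₂, hq₂, hM₂⟩ := exists_mover_of_mk_eq_mk_frame C.J C.hJsmul C.b C.bq C.hb C.hJrat Kc.1.1 C.hle C.piece C.Z C.rep C.q C.q_spec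
    (fun b' : 𝓞 F => C.ρ₀ b') (fun a'' (b' : 𝓞 F) => C.Mρ a'' b') C.Mρ_frame C.bq_comm_ρ₀ v' hv' a' (fun i => ι₁ (w i)) hw (d' * a₀) h₂'
  exact exists_cmConjHom_kernelShape_frame_of_restrictScalars C.hg C.hδ (Fin 2) (fun _ => F) c
    ⟨C.J (fun i => ι₁ (w i)), C.hJ _ hw⟩ Ψ hsp E hE σ hσE sE hsE r hr (C.b a₀) (C.b (d' * a₀)) t m₁ m₂ q₁ q₂
    hJ₁ hq₁ hJ₂ hq₂ ht hsplit (C.rep_spec _).2.2.1 (fun b' : 𝓞 F => C.ρ₀ b') (fun b' : 𝓞 F => C.Mρ a b') (fun b' : 𝓞 F => C.Mρ a' b')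
    (fun b' => ⟨fun _ => ((b' : 𝓞 F) : F), hpin b'⟩) hM₁ hM₂

/-- **THE TWO CLASS IDENTITIES OF A SPECIAL POINT AND ITS `σ`-TWIST** (record reciprocity (F3) `S.recip` + Artin surjectivity + the diagonal twist): for
`σ ∈ Aut(ℂ∕Fᵢ)` (read over `F` along `τE ∘ (F → Fᵢ) = ι₁`), the flat special point `Pflat = (S.pts Kc)⁻¹ [ι₁w, a₀]` and a flat point `Pflat′` with
`Pflat′ = Spec σ ≫ Pflat`, there are an `F`-idèle Artin correspondent `s` of `σ` and a twist `d` by `r_w(s)` such that ANY representative `(v, a)` of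
`S.pts Pflat` lies in the class `[ι₁w, a₀]` and ANY representative `(v′, a′)` of `S.pts Pflat′` lies in `[ι₁w, d·a₀]`.
[cite: Milne2005ShimuraVarieties, Def. 12.8 (59)–(62) p. 114] [cite: Deligne1979ShimuraVarieties, 2.2.5] -/
theorem exists_artin_twist_classes {F : Type} [Field F] [NumberField F] [IsCMField F] {ι₁ : F →+* ℂ}
    {Jstar : Matrix (Fin 2) (Fin 2) F} (hJ : (Jstar.map (IsCMField.complexConj F))ᵀ = Jstar)
    {K₀ : C5.OpenCompactSubgroup (GSAdele F Jstar)} (S : RecordSystemGS F Jstar ι₁ K₀) (Kc : C5.SmallLevel K₀)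
    {Fi : Type} [Field Fi] [NumberField Fi] [Algebra F Fi] {τE : Fi →+* ℂ} (hτE : τE.comp (algebraMap F Fi) = ι₁)
    (σ : letI : Algebra Fi ℂ := τE.toAlgebra; ℂ ≃ₐ[Fi] ℂ)
    (w : Fin 2 → F) (hw : (fun i => ι₁ (w i)) ∈ negCone (Jstar.map ι₁)) (a₀ : GSAdele F Jstar)
    (Pflat : letI : Algebra F ℂ := ι₁.toAlgebra; ComplexPoints (S.M.obj Kc))
    (hPflat : letI : Algebra F ℂ := ι₁.toAlgebra; Pflat = (S.pts Kc).symm (ShimuraSetGS.mk F Jstar ι₁ Kc.1.1 (fun i => ι₁ (w i)) hw a₀))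
    (v : Fin 2 → ℂ) (hv : v ∈ negCone (Jstar.map ι₁)) (a : GSAdele F Jstar)
    (hpts : letI : Algebra F ℂ := ι₁.toAlgebra; S.pts Kc Pflat = ShimuraSetGS.mk F Jstar ι₁ Kc.1.1 v hv a)
    (Pflat' : letI : Algebra F ℂ := ι₁.toAlgebra; ComplexPoints (S.M.obj Kc))
    (hPflat' : letI : Algebra Fi ℂ := τE.toAlgebra; Pflat'.left = AbelianSchemeOver.specTwist σ.toRingEquiv ≫ Pflat.left)
    (v' : Fin 2 → ℂ) (hv' : v' ∈ negCone (Jstar.map ι₁)) (a' : GSAdele F Jstar)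
    (hpts' : letI : Algebra F ℂ := ι₁.toAlgebra; S.pts Kc Pflat' = ShimuraSetGS.mk F Jstar ι₁ Kc.1.1 v' hv' a') :
    letI : Algebra Fi ℂ := τE.toAlgebra
    ∃ (s : (FiniteAdeleRing (𝓞 F) F)ˣ) (d : GSAdele F Jstar),
      IsArtinCorrespondent F ι₁ s σ.toRingEquiv ∧ IsDiagTwistGS F Jstar w (recipFactor F s) d ∧
      ShimuraSetGS.mk F Jstar ι₁ Kc.1.1 v hv a = ShimuraSetGS.mk F Jstar ι₁ Kc.1.1 (fun i => ι₁ (w i)) hw a₀ ∧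
      ShimuraSetGS.mk F Jstar ι₁ Kc.1.1 v' hv' a' = ShimuraSetGS.mk F Jstar ι₁ Kc.1.1 (fun i => ι₁ (w i)) hw (d * a₀) := by
  letI iFi : Algebra Fi ℂ := τE.toAlgebra
  letI iF : Algebra F ℂ := ι₁.toAlgebra
  haveI : IsScalarTower F Fi ℂ := IsScalarTower.of_algebraMap_eq fun x => (RingHom.congr_fun hτE x).symm
  -- `σ` over `F` (same underlying map), an Artin correspondent of it over `F`, and the twist at `w`
  have hσF : (σ.restrictScalars F).toRingEquiv = σ.toRingEquiv := RingEquiv.ext fun _ => rfl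
  obtain ⟨sF, hsF⟩ := exists_finiteIdele_isArtinCorrespondent_algEquiv F ι₁ (σ.restrictScalars F)
  obtain ⟨d, hd⟩ := exists_isDiagTwistGS_recipFactor' F Jstar hJ (hermForm_self_ne_zero_of_embedding_mem_negCone hw) sF
  refine ⟨sF, d, by rw [← hσF]; exact hsF, hd, ?_, ?_⟩
  · rw [← hpts, hPflat, Homeomorph.apply_symm_apply]
  · -- the twisted flat point IS `σ • Pflat`; its class is `[ι₁w, d·a₀]` by (F3)
    have hRH : σ.toRingEquiv.toRingHom = ((σ.restrictScalars F : ℂ ≃ₐ[F] ℂ) : ℂ →+* ℂ) := RingHom.ext fun _ => rfl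
    have hP' : Pflat' = (σ.restrictScalars F) • Pflat := by
      apply Over.OverMorphism.ext
      rw [AlgPoints.smul_left, hPflat', ← hRH]
    rw [← hpts', hP', hPflat, S.recip Kc (σ.restrictScalars F) sF hsF w hw d hd a₀, Homeomorph.apply_symm_apply]

end KCMPayment

/-! ## §2 THE REGISTERED-SHAPE STUB `stub_KCM` — PAID (LA6-p01 (g0) snippet v2 2abae4a7; boxed GREEN LA6-r01 #10 ∕ LAref-E L6 #4) -/


set_option maxHeartbeats 400000 in  -- the two `obtain`s unify the fibre-variety-valued marking types (measured: > 200 000, < 400 000; cell rule r4 cap)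
/-- **`stub_KCM` — THE CM INPUTS OF THE Σ-GAL KERNEL** ((K-a) the CM structure of the special point moved to `J(Z a v)` by the mover `q_a` — ★ E3R
`isSpecial_auxComplexStructureV_curve`; (K-b) the CM homomorphism `f` with its `K_δ(N)`-twisted torsion reading — ★ `cmConjugationIsogenyAll_holds`
re-indexed along the class identity (E3R-S ★ `smul_q_mk_eq_q_mk_cmRecip…`, record (F3)∕`f_recip`, ★ MRK-TRANSPORT); (K-c) the congruence
preservation of `(Mρ a b, Mρ a′ b)` — A-p15 (g18), needs the E-line ED. 5 field (M-fr)).  In every E-line letter context, for every family `Y`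
READING through the admissible markings (`ReadsCReading`), `KCMInputs C ε Y hY`. [cite: Milne2005ShimuraVarieties, §14 Prop. 14.12 p. 125; §11 Thm. 11.2 p. 108]
[cite: Deligne1971TravauxShimura, 4.19–4.21 pp. 151–152] -/
theorem stub_KCM : ∀ (F : Type) [Field F] [NumberField F] [IsCMField F] [IsGalois ℚ F] (ι₁ : F →+* ℂ)
      (Jstar : Matrix (Fin 2) (Fin 2) F) (_hJ : (Jstar.map (IsCMField.complexConj F))ᵀ = Jstar) (_hJu : IsUnit Jstar)
      (K₀ : C5.OpenCompactSubgroup (GSAdele F Jstar)) (S : RecordSystemGS F Jstar ι₁ K₀) (Kc : C5.SmallLevel K₀)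
      (Fi : Type) [Field Fi] [NumberField Fi] [Algebra F Fi] [IsGalois F Fi] (τE : Fi →+* ℂ) (_hτE : τE.comp (algebraMap F Fi) = ι₁)
      (Φ : Set (F →+* ℂ)) (_hΦ : IsCMTypeThrough ι₁ Φ) (C : AuxChartGS F ι₁ Jstar K₀ S Kc Fi τE Φ)
      (ε : (Literature.AlgebraicGeometry.Motives.baseChange F Fi).obj (S.M.obj Kc) ⟶
          (Literature.AlgebraicGeometry.Motives.baseChange ℚ Fi).obj C.𝓜.M)
      (_hε : letI : Algebra Fi ℂ := τE.toAlgebra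
        ∀ (P : ComplexPoints ((Literature.AlgebraicGeometry.Motives.baseChange F Fi).obj (S.M.obj Kc)))
          (Pflat : letI : Algebra F ℂ := ι₁.toAlgebra; ComplexPoints (S.M.obj Kc)),
          Pflat.left = P.left ≫ pullback.fst (S.M.obj Kc).hom (bcSpec F Fi) →
          (AlgPoints.map ε P).left ≫ pullback.fst C.𝓜.M.hom (bcSpec ℚ Fi) =
            (letI : Algebra F ℂ := ι₁.toAlgebra; (C.f (S.pts Kc Pflat)).left))
      (_hU : Literature.AlgebraicGeometry.ModuliOfAbelianVarieties.siegelUniversalFamilyUniformisation),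
      ∀ Y hY, ReadsCReading C ε Y hY → KCMInputs C ε Y hY := by
  -- PAID (LA6-p01 (g0)): the two class identities (`exists_artin_twist_classes`) + the CM chain (`kcm_chain_of_cm_recip`).
  intro F _ _ _ _ ι₁ Jstar hJ _hJu K₀ S Kc Fi _ _ _ _ τE hτE Φ _hΦ C ε _hε _hU Y hY _hRead b σ s w hw a₀ Pflat hPflat _hs v hv a hpts m₁ Θ₁ Λ₁
    _ _ _ _ _ Pflat' hPflat' v' hv' a' hpts' m₂ Θ₂ Λ₂ _ _ _ _ _
  obtain ⟨sF, d, hsF, hd, h₁, h₂⟩ := exists_artin_twist_classes hJ S Kc hτE σ w hw a₀ Pflat hPflat v hv a hpts Pflat' hPflat' v' hv' a' hpts'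
  obtain ⟨f, k, hk, hf, hℓ⟩ := kcm_chain_of_cm_recip C σ sF hsF w hw d hd a₀ v hv a h₁ v' hv' a' h₂ m₁ m₂
  exact ⟨f, k, hk, hf, hℓ b⟩


/-! ## §3a Generic glue: the TORUS READING of a fibre endomorphism from its point reading (★ H1 shape) and the σ1 chart reading -/

section TorusReading

open Literature.AlgebraicGeometry.Motives (CartierDivisor)

/-- **Torus reading from the two point readings.**  `B → T` an abelian scheme, `g : T′ → T`, `π : T′ → Spec ℂ`, `Yl` an endomorphism of the
underlying scheme of `B ×_T T′`, `x : Spec ℂ → T′` honest (`x ≫ π = 𝟙`) over `s = x ≫ g`, `m` a marking of `B_s`, `y` an endomorphism of `B_s`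
READING `Yl` at the points over `x` (★ H1's `hread` shape) and `Yl` READING as `ρ(M)` through `m` at the honest points (σ1's `ReadsCReading` clause
shape).  Then `y (m.toFun t) = m.toFun (ρ(M) t)` for every `t` (the point `q := (pt_B (toFun t), x)` of `B ×_T T′` feeds both readings; ★
`fibrePointToLeft_injective`). [cite: MumfordFogartyKirwan1994, Ch. 6 §2 Definition 6.3 (p. 120)] [cite: Milne2005ShimuraVarieties, §6 Thm. 6.11 pp. 74–75] -/
theorem map_toFun_eq_mapMatrix_of_readings {T T' : Scheme.{0}} (B : AbelianSchemeOver T) (g : T' ⟶ T) (π : T' ⟶ Spec (.of ℂ))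
    (Yl : pullback B.X.hom g ⟶ pullback B.X.hom g) (x : Spec (.of ℂ) ⟶ T') (hx : x ≫ π = 𝟙 _) (s : Spec (.of ℂ) ⟶ T) (hxs : x ≫ g = s)
    {g₀ : ℕ} {δ : Fin g₀ → ℕ} {J : C0pm δ} {r : gspFinAdelic δ} (m : SiegelAdelicMarking J r (B.fibre s).toAbelianVariety)
    (y : (B.fibre s).toAbelianVariety ⟶ (B.fibre s).toAbelianVariety) (M : Matrix (Fin g₀ ⊕ Fin g₀) (Fin g₀ ⊕ Fin g₀) ℤ)
    (hready : ∀ (q : Spec (.of ℂ) ⟶ pullback B.X.hom g) (P : (B.fibre s).toAbelianVariety.Points ℂ),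
      q ≫ pullback.snd B.X.hom g = x → q ≫ pullback.fst B.X.hom g = B.fibrePointToLeft s P →
        (q ≫ Yl) ≫ pullback.fst B.X.hom g = B.fibrePointToLeft s (AlgPoints.map y.hom.hom.hom P))
    (hread : ∀ (t : ComplexTorus m.Ψ) (q : Spec (.of ℂ) ⟶ pullback B.X.hom g),
      q ≫ pullback.fst B.X.hom g = B.fibrePointToLeft s (m.toFun t) → q ≫ pullback.snd B.X.hom g ≫ π = 𝟙 _ →
        (q ≫ Yl) ≫ pullback.fst B.X.hom g = B.fibrePointToLeft s (m.toFun (ComplexTorus.mapMatrix m.Ψ m.Ψ M t)))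
    (t : ComplexTorus m.Ψ) :
    AlgPoints.map y.hom.hom.hom (m.toFun t) = m.toFun (ComplexTorus.mapMatrix m.Ψ m.Ψ M t) := by
  have hw₀ : B.fibrePointToLeft s (m.toFun t) ≫ B.X.hom = x ≫ g := by rw [hxs]; exact B.fibrePointToLeft_comp_hom _ _
  have hq₁ : pullback.lift (B.fibrePointToLeft s (m.toFun t)) x hw₀ ≫ pullback.fst B.X.hom g = B.fibrePointToLeft s (m.toFun t) :=
    pullback.lift_fst _ _ _
  have hq₂ : pullback.lift (B.fibrePointToLeft s (m.toFun t)) x hw₀ ≫ pullback.snd B.X.hom g = x := pullback.lift_snd _ _ _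
  have h1 := hready _ (m.toFun t) hq₂ hq₁
  have h2 := hread t _ hq₁ (by rw [reassoc_of% hq₂, hx])
  exact AbelianSchemeOver.fibrePointToLeft_injective (B := B) _ (h1.symm.trans h2)

end TorusReading


/-! (★ re-home, size lint: this is PART A of `Lines/…` — the file continues, in the same namespace, in `Theorems/F0P6aSigmaGAL.lean`.) -/

end Summit.HodgeConjecture.HodgeConjecture.Cruxes.HLiu418.F0P6aSigmaGAL

end
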